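import Literature.IUT.LogVolume.HeightDivisor
import Literature.IUT.LogVolume.PrincipalArithmeticDivisors
import Mathlib.NumberTheory.Height.NumberField
import HarnessLib

/-!
# Conductor of a fibre versus heights: the summation over ALL places of a number field

Support lemma for the abc-iut cell's route item `Summit.ABC.ABC.Theses.IUTThetaPilot.GenEllTwo`
(ledger `stmt-ABC-19679`; [GenEll] = S. Mochizuki, *Arithmetic elliptic curves in general position*,
Math. J. Okayama Univ. **52** (2010), Thm. 2.1, proof pp. 12–13, the "sharp Prop. 1.6" step
`log-cond_E(y) ≲ ht_{𝒪(E)}(y)` for the REDUCED fibre divisor `E = φ⁻¹({0,1,∞})_red` of a Belyi map;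
cell work package W5 of `GENELLTWO-P1ROUTE.md` §3 (d), piece "W5d: the κ-summation").

Everything here is CLASSICAL height bookkeeping over a number field `L` and is stated abstractly —
no curve, no Belyi map: given

* an element `a : L` (in the application: the value `N(P)` of a form cutting out the ramification
  divisor of the map `t`),
* a finite family `τ : ι → L` (the values `T_b(P)`, `b ∈ B`, of integral forms cutting out the fibres
  `t⁻¹(b)`),
* a finite set `W` of finite places (the places where the point MEETS the fibre — the support of the
  conductor one wants to bound),
* a "defect" `d : (finite places) → ℕ` supported on a finite set `Sd` (zero at the good places; at the
  finitely many bad places whatever the local analysis leaves over),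

and the PLACEWISE multiplicity inequalities

* `w ∈ W`:  `1 + ord⁺_w(a) ≤ Σ_b ord⁺_w(τ_b) + d(w)`   (at a good meeting place: the fibre form vanishes
  to order ≥ 1 + the order of the ramification form — [GenEll] p. 12 "sharp form of Prop. 1.6"),
* `w ∉ W`:  `ord⁺_w(a) ≤ Σ_b ord⁺_w(τ_b) + d(w)`       (off the meeting places the ramification form is a
  unit at good places),

together with an archimedean proximity bound `Σ_{v∣∞} [L_v:ℝ]·log⁺|a⁻¹|_v ≤ A` and the defect bound
`Σ_{w ∈ Sd} d(w)·log N(w) ≤ D`, one gets the GLOBAL inequality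

  `Σ_{w ∈ W} log N(w) ≤ Σ_b h_L(τ_b) − h_L(a) + A + D`                    (`sum_logNorm_le_of_placewise`)

where `h_L = logHeight₁` is Mathlib's (unnormalised) logarithmic Weil height on `L`.  Dividing by
`[L:ℚ]` gives the normalised form used in [GenEll].  The ENGINE is the finite-place part of the Weil
height (`sum_toNat_ord_mul_logNorm_eq`):

  `Σ_w ord⁺_w(x)·log N(w) = h_L(x) − Σ_{v∣∞} [L_v:ℝ]·log⁺|x⁻¹|_v`   (`x ≠ 0`),

an immediate consequence of Mathlib's `NumberField.logHeight₁_eq` applied to `x⁻¹`, `logHeight₁_inv`,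
and the tree's `‖x‖_w = N(w)^{−ord_w(x)}` (`Literature.IUT.LogVolume.posLog_adicAbv_eq`).  No new
definitions; nothing here refers to the disputed parts of the abc-iut corpus. Source for the shape of
the argument (heights as sums of local contributions, conductor ≤ height of a vanishing form):
Bombieri–Gubler, *Heights in Diophantine Geometry* (CUP 2006) §1.5–§2.3 [cite: BombieriGubler2006,
§2.3]; the application is [cite: MochizukiGenEll2010, Thm 2.1 proof pp.12-13].
-/

noncomputable section

open NumberField IsDedekindDomain Height Real Finset
open Literature.IUT.LogVolume

namespace Literature.NumberTheory.DiophantineGeometry.FibreConductor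

variable {L : Type*} [Field L] [NumberField L]

/-! ## Dictionary: the finite place `‖·‖_w`, the order `ord_w`, and `log⁺` -/

/-- `‖x⁻¹‖_w = N(w)^{ord_w(x)}` for `x ≠ 0` (Mathlib's finite place attached to `w`).
[cite: BombieriGubler2006, §1.4] -/
theorem finitePlace_mk_inv_eq_zpow (w : HeightOneSpectrum (𝓞 L)) {x : L} (hx : x ≠ 0) :
    FinitePlace.mk w x⁻¹ = (Ideal.absNorm w.asIdeal : ℝ) ^ (ord L w x) := by
  rw [FinitePlace.mk_apply, FinitePlace.norm_embedding, adicAbv_eq_absNorm_zpow L w (inv_ne_zero hx),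
    ord_inv, neg_neg]

/-- `log⁺‖x⁻¹‖_w = ord⁺_w(x)·log N(w)` with `ord⁺ := max(0, ord)` (as `Int.toNat`); both sides vanish for
`x = 0` by the junk conventions. [cite: BombieriGubler2006, §1.5] -/
theorem posLog_adicAbv_inv_eq (w : HeightOneSpectrum (𝓞 L)) (x : L) :
    log⁺ (NumberField.HeightOneSpectrum.adicAbv L w x⁻¹) = ((ord L w x).toNat : ℝ) * logNorm L w := by
  rw [posLog_adicAbv_eq L w x⁻¹, ord_inv, neg_neg]

/-- `log⁺ (w x⁻¹) = ord⁺_w(x)·log N(w)` for a Mathlib finite place `w`, read at its maximal ideal.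
[cite: BombieriGubler2006, §1.5] -/
theorem posLog_finitePlace_inv_eq (w : FinitePlace L) (x : L) :
    log⁺ (w x⁻¹) = ((ord L w.maximalIdeal x).toNat : ℝ) * logNorm L w.maximalIdeal := by
  rw [← posLog_adicAbv_inv_eq, ← FinitePlace.norm_embedding, ← FinitePlace.mk_apply,
    FinitePlace.mk_maximalIdeal]

/-- `ord_w(x) > 0 ↔ x ≡ 0 (mod w)` in valuation form: `0 < ord_w(x) ↔ v_w(x) < 1` (`x ≠ 0`) — the
"meets" dictionary for consumers whose local lemmas are stated with `w.valuation L`.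
[cite: BombieriGubler2006, §1.4] -/
theorem ord_pos_iff (w : HeightOneSpectrum (𝓞 L)) {x : L} (hx : x ≠ 0) :
    0 < ord L w x ↔ w.valuation L x < 1 :=
  ord_pos_iff_valuation_lt_one L w hx

/-- `0 < ord_w(x)` iff `‖x‖_w < 1` for the finite place of Mathlib (`x ≠ 0`). [cite: BombieriGubler2006, §1.4] -/
theorem ord_pos_iff_finitePlace_lt_one (w : HeightOneSpectrum (𝓞 L)) {x : L} (hx : x ≠ 0) :
    0 < ord L w x ↔ FinitePlace.mk w x < 1 := by
  have hN : (1 : ℝ) < (Ideal.absNorm w.asIdeal : ℝ) := by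
    exact_mod_cast NumberField.HeightOneSpectrum.one_lt_absNorm w
  rw [FinitePlace.mk_apply, FinitePlace.norm_embedding, adicAbv_eq_absNorm_zpow L w hx]
  constructor
  · intro h
    exact zpow_lt_one_of_neg₀ hN (by omega)
  · intro h
    by_contra hle
    push Not at hle
    have : (1 : ℝ) ≤ (Ideal.absNorm w.asIdeal : ℝ) ^ (-ord L w x) := one_le_zpow₀ hN.le (by omega)
    exact absurd h (not_lt.mpr this)

/-- `1 ≤ ord⁺_w(x)` as soon as `x ≠ 0` lies in `w` (`v_w(x) < 1`). [cite: BombieriGubler2006, §1.4] -/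
theorem one_le_toNat_ord_of_valuation_lt_one (w : HeightOneSpectrum (𝓞 L)) {x : L} (hx : x ≠ 0)
    (h : w.valuation L x < 1) : 1 ≤ (ord L w x).toNat := by
  have := (ord_pos_iff w hx).mpr h
  omega

/-- Only finitely many finite places have `ord⁺_w(x) ≠ 0`. [cite: BombieriGubler2006, §1.4] -/
theorem finite_setOf_ord_pos (x : L) : {w : HeightOneSpectrum (𝓞 L) | 0 < ord L w x}.Finite :=
  (finite_setOf_ord_ne_zero L x).subset fun _ hw => ne_of_gt hw

/-! ## Engine: the finite-place part of the Weil height -/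

/-- The archimedean proximity term `Σ_{v∣∞} [L_v:ℝ]·log⁺|x⁻¹|_v` is non-negative.
[cite: BombieriGubler2006, §1.5] -/
theorem sum_mult_mul_posLog_inv_nonneg (x : L) :
    0 ≤ ∑ v : InfinitePlace L, (v.mult : ℝ) * log⁺ (v x⁻¹) :=
  Finset.sum_nonneg fun _ _ => mul_nonneg (Nat.cast_nonneg _) posLog_nonneg

/-- **Finite part of the Weil height.** For `x : L` and any finite set `T` of finite places containing
every `w` with `ord_w(x) > 0`:
`Σ_{w ∈ T} ord⁺_w(x)·log N(w) = logHeight₁ x − Σ_{v∣∞} [L_v:ℝ]·log⁺|x⁻¹|_v`.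
(Mathlib's `logHeight₁ x⁻¹ = logHeight₁ x` and `NumberField.logHeight₁_eq`.) [cite: BombieriGubler2006, §1.5] -/
theorem sum_toNat_ord_mul_logNorm_eq (x : L) (T : Finset (HeightOneSpectrum (𝓞 L)))
    (hT : ∀ w, 0 < ord L w x → w ∈ T) :
    ∑ w ∈ T, ((ord L w x).toNat : ℝ) * logNorm L w =
      logHeight₁ x - ∑ v : InfinitePlace L, (v.mult : ℝ) * log⁺ (v x⁻¹) := by
  have hht : logHeight₁ x⁻¹ =
      (∑ v : InfinitePlace L, (v.mult : ℝ) * log⁺ (v x⁻¹)) + ∑ᶠ w : FinitePlace L, log⁺ (w x⁻¹) :=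
    NumberField.logHeight₁_eq x⁻¹
  rw [Height.logHeight₁_inv] at hht
  -- the finite sum over Mathlib's finite places, reindexed by maximal ideals
  have hfin : ∑ᶠ w : FinitePlace L, log⁺ (w x⁻¹) =
      ∑ᶠ w : HeightOneSpectrum (𝓞 L), ((ord L w x).toNat : ℝ) * logNorm L w := by
    rw [← finsum_comp_equiv FinitePlace.equivHeightOneSpectrum.symm]
    refine finsum_congr fun w => ?_
    simp only [FinitePlace.equivHeightOneSpectrum_symm_apply, FinitePlace.norm_embedding]
    exact posLog_adicAbv_inv_eq w x
  have hsum : ∑ᶠ w : HeightOneSpectrum (𝓞 L), ((ord L w x).toNat : ℝ) * logNorm L w =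
      ∑ w ∈ T, ((ord L w x).toNat : ℝ) * logNorm L w := by
    refine finsum_eq_sum_of_support_subset _ fun w hw => ?_
    rw [Function.mem_support] at hw
    refine Finset.mem_coe.mpr (hT w ?_)
    by_contra h
    apply hw
    have : (ord L w x).toNat = 0 := Int.toNat_eq_zero.mpr (not_lt.mp h)
    simp [this]
  rw [← hsum, ← hfin]
  linarith

/-- Dropping the archimedean term: `Σ_{w ∈ T} ord⁺_w(x)·log N(w) ≤ logHeight₁ x` — the
"fundamental inequality" (number of zeros counted with norms ≤ height). [cite: BombieriGubler2006, §1.5] -/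
theorem sum_toNat_ord_mul_logNorm_le_logHeight₁ (x : L) (T : Finset (HeightOneSpectrum (𝓞 L))) :
    ∑ w ∈ T, ((ord L w x).toNat : ℝ) * logNorm L w ≤ logHeight₁ x := by
  classical
  -- enlarge `T` to contain every place of positive order, then use the equality
  set T' : Finset (HeightOneSpectrum (𝓞 L)) := T ∪ (finite_setOf_ord_pos x).toFinset with hT'
  have hsub : T ⊆ T' := Finset.subset_union_left
  have hle : ∑ w ∈ T, ((ord L w x).toNat : ℝ) * logNorm L w ≤
      ∑ w ∈ T', ((ord L w x).toNat : ℝ) * logNorm L w :=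
    Finset.sum_le_sum_of_subset_of_nonneg hsub fun w _ _ =>
      mul_nonneg (Nat.cast_nonneg _) (logNorm_pos L w).le
  have heq := sum_toNat_ord_mul_logNorm_eq x T' fun w hw =>
    Finset.mem_union_right _ ((finite_setOf_ord_pos x).mem_toFinset.mpr hw)
  have := sum_mult_mul_posLog_inv_nonneg x
  linarith

/-- The other direction: `logHeight₁ x − Σ_{v∣∞} [L_v:ℝ]·log⁺|x⁻¹|_v ≤ Σ_{w ∈ T} ord⁺_w(x)·log N(w)` for
ANY finite `T` containing the places of positive order (equality there; stated as `≤` for chaining).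
[cite: BombieriGubler2006, §1.5] -/
theorem logHeight₁_sub_arch_le_sum_toNat_ord (x : L) (T : Finset (HeightOneSpectrum (𝓞 L)))
    (hT : ∀ w, 0 < ord L w x → w ∈ T) :
    logHeight₁ x - ∑ v : InfinitePlace L, (v.mult : ℝ) * log⁺ (v x⁻¹) ≤
      ∑ w ∈ T, ((ord L w x).toNat : ℝ) * logNorm L w :=
  (sum_toNat_ord_mul_logNorm_eq x T hT).ge

/-! ## The summation -/

/-- **Conductor of the meeting places versus heights (placewise ⇒ global).**  Let `a : L`, a finite
family `τ : ι → L`, a finite set `W` of finite places ("meeting places"), a defect `d` vanishing off the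
finite set `Sd` with `Σ_{w ∈ Sd} d(w)·log N(w) ≤ D`, and an archimedean bound
`Σ_{v∣∞} [L_v:ℝ]·log⁺|a⁻¹|_v ≤ A`.  If at every `w ∈ W` one has `1 + ord⁺_w(a) ≤ Σ_i ord⁺_w(τ_i) + d(w)`
and at every other finite place `ord⁺_w(a) ≤ Σ_i ord⁺_w(τ_i) + d(w)`, then
`Σ_{w ∈ W} log N(w) ≤ Σ_i logHeight₁(τ_i) − logHeight₁(a) + A + D`.
This is the global form of [GenEll]'s "sharp Prop. 1.6" for a reduced fibre: the multiplicity saved at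
the ramification points (the order of `a`) is recovered from the height of `a` by the product formula,
at the price of the archimedean proximity term `A`. [cite: MochizukiGenEll2010, Thm 2.1 proof pp.12-13] -/
theorem sum_logNorm_le_of_placewise {ι : Type*} [Fintype ι] (a : L) (τ : ι → L)
    (W Sd : Finset (HeightOneSpectrum (𝓞 L))) (d : HeightOneSpectrum (𝓞 L) → ℕ) {A D : ℝ}
    (hmeet : ∀ w ∈ W, 1 + (ord L w a).toNat ≤ (∑ i, (ord L w (τ i)).toNat) + d w)
    (hoff : ∀ w, w ∉ W → (ord L w a).toNat ≤ (∑ i, (ord L w (τ i)).toNat) + d w)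
    (hdS : ∀ w, w ∉ Sd → d w = 0)
    (hD : ∑ w ∈ Sd, (d w : ℝ) * logNorm L w ≤ D)
    (hA : ∑ v : InfinitePlace L, (v.mult : ℝ) * log⁺ (v a⁻¹) ≤ A) :
    ∑ w ∈ W, logNorm L w ≤ (∑ i, logHeight₁ (τ i)) - logHeight₁ a + A + D := by
  classical
  -- one finite set of places carrying everything
  set T : Finset (HeightOneSpectrum (𝓞 L)) :=
    W ∪ Sd ∪ (finite_setOf_ord_pos a).toFinset ∪
      Finset.univ.biUnion (fun i => (finite_setOf_ord_pos (τ i)).toFinset) with hTdef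
  have hWT : W ⊆ T := by
    intro w hw; simp only [hTdef, Finset.mem_union]; exact Or.inl (Or.inl (Or.inl hw))
  have hSdT : Sd ⊆ T := by
    intro w hw; simp only [hTdef, Finset.mem_union]; exact Or.inl (Or.inl (Or.inr hw))
  have haT : ∀ w, 0 < ord L w a → w ∈ T := by
    intro w hw; simp only [hTdef, Finset.mem_union]
    exact Or.inl (Or.inr ((finite_setOf_ord_pos a).mem_toFinset.mpr hw))
  have hτT : ∀ i w, 0 < ord L w (τ i) → w ∈ T := by
    intro i w hw; simp only [hTdef, Finset.mem_union, Finset.mem_biUnion, Finset.mem_univ, true_and]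
    exact Or.inr ⟨i, (finite_setOf_ord_pos (τ i)).mem_toFinset.mpr hw⟩
  -- the placewise inequality, multiplied by `log N(w) > 0` and summed over `T`
  have hplace : ∀ w ∈ T,
      (if w ∈ W then logNorm L w else 0) + ((ord L w a).toNat : ℝ) * logNorm L w ≤
        (∑ i, ((ord L w (τ i)).toNat : ℝ) * logNorm L w) + (d w : ℝ) * logNorm L w := by
    intro w _
    have hN : 0 < logNorm L w := logNorm_pos L w
    by_cases hw : w ∈ W
    · have h := hmeet w hw
      have h' : (1 : ℝ) + ((ord L w a).toNat : ℝ) ≤ (∑ i, ((ord L w (τ i)).toNat : ℝ)) + (d w : ℝ) := by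
        exact_mod_cast h
      rw [if_pos hw, ← Finset.sum_mul]
      nlinarith
    · have h := hoff w hw
      have h' : ((ord L w a).toNat : ℝ) ≤ (∑ i, ((ord L w (τ i)).toNat : ℝ)) + (d w : ℝ) := by
        exact_mod_cast h
      rw [if_neg hw, zero_add, ← Finset.sum_mul]
      nlinarith
  have hsumT := Finset.sum_le_sum hplace
  -- identify the four sums
  have h1 : ∑ w ∈ T, (if w ∈ W then logNorm L w else 0) = ∑ w ∈ W, logNorm L w := by
    rw [← Finset.sum_filter, Finset.filter_mem_eq_inter, Finset.inter_eq_right.mpr hWT]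
  have h2 : ∑ w ∈ T, ((ord L w a).toNat : ℝ) * logNorm L w =
      logHeight₁ a - ∑ v : InfinitePlace L, (v.mult : ℝ) * log⁺ (v a⁻¹) :=
    sum_toNat_ord_mul_logNorm_eq a T haT
  have h3 : ∀ i, ∑ w ∈ T, ((ord L w (τ i)).toNat : ℝ) * logNorm L w ≤ logHeight₁ (τ i) :=
    fun i => sum_toNat_ord_mul_logNorm_le_logHeight₁ (τ i) T
  have h4 : ∑ w ∈ T, (d w : ℝ) * logNorm L w = ∑ w ∈ Sd, (d w : ℝ) * logNorm L w := by
    symm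
    refine Finset.sum_subset hSdT fun w _ hw => ?_
    simp [hdS w hw]
  rw [Finset.sum_add_distrib, Finset.sum_add_distrib, h1, h2, h4, Finset.sum_comm] at hsumT
  have h3' : ∑ i, ∑ w ∈ T, ((ord L w (τ i)).toNat : ℝ) * logNorm L w ≤ ∑ i, logHeight₁ (τ i) :=
    Finset.sum_le_sum fun i _ => h3 i
  linarith

/-- **The good/bad-prime form** (the shape of `GENELLTWO-P1ROUTE.md` §3 (d) with the bad primes
separated): `Sbad` a finite set of finite places; at the GOOD places the sharp inequalities hold with no
defect; at the bad places one only knows `Σ_{w ∈ Sbad} ord⁺_w(a)·log N(w) ≤ C` (e.g. from separation of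
the point from the zeros of the ramification form at those places).  Then
`Σ_{w ∈ W} log N(w) ≤ Σ_i logHeight₁(τ_i) − logHeight₁(a) + A + C + Σ_{w ∈ Sbad} log N(w)`.
[cite: MochizukiGenEll2010, Thm 2.1 proof pp.12-13] -/
theorem sum_logNorm_le_of_good_bad {ι : Type*} [Fintype ι] (a : L) (τ : ι → L)
    (W Sbad : Finset (HeightOneSpectrum (𝓞 L))) {A C : ℝ}
    (hmeet : ∀ w ∈ W, w ∉ Sbad → 1 + (ord L w a).toNat ≤ ∑ i, (ord L w (τ i)).toNat)
    (hoff : ∀ w, w ∉ W → w ∉ Sbad → (ord L w a).toNat ≤ ∑ i, (ord L w (τ i)).toNat)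
    (hbad : ∑ w ∈ Sbad, ((ord L w a).toNat : ℝ) * logNorm L w ≤ C)
    (hA : ∑ v : InfinitePlace L, (v.mult : ℝ) * log⁺ (v a⁻¹) ≤ A) :
    ∑ w ∈ W, logNorm L w ≤
      (∑ i, logHeight₁ (τ i)) - logHeight₁ a + A + (C + ∑ w ∈ Sbad, logNorm L w) := by
  classical
  -- defect: at a bad place, everything the left-hand side asks for
  let d : HeightOneSpectrum (𝓞 L) → ℕ := fun w => if w ∈ Sbad then 1 + (ord L w a).toNat else 0
  refine sum_logNorm_le_of_placewise a τ W Sbad d ?_ ?_ ?_ ?_ hA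
  · intro w hw
    by_cases hb : w ∈ Sbad
    · simp only [d, if_pos hb]; omega
    · simp only [d, if_neg hb, add_zero]; exact hmeet w hw hb
  · intro w hw
    by_cases hb : w ∈ Sbad
    · simp only [d, if_pos hb]; omega
    · simp only [d, if_neg hb, add_zero]; exact hoff w hw hb
  · intro w hw; simp [d, hw]
  · have : ∑ w ∈ Sbad, ((d w : ℕ) : ℝ) * logNorm L w =
        ∑ w ∈ Sbad, (logNorm L w + ((ord L w a).toNat : ℝ) * logNorm L w) := by
      refine Finset.sum_congr rfl fun w hw => ?_
      simp only [d, if_pos hw]; push_cast; ring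
    rw [this, Finset.sum_add_distrib]
    linarith


/-! ## Conveniences for the consumers (per-place archimedean bounds; normalised heights) -/

/-- From a UNIFORM archimedean proximity bound `log⁺|x⁻¹|_v ≤ c` at every infinite place (e.g. the
point's conjugates are `r`-separated from the zeros of the ramification form, so `|N(σP)| ≥ e^{−c}`),
the weighted archimedean term is at most `[L:ℚ]·c` (`Σ_v [L_v:ℝ] = [L:ℚ]`).
[cite: BombieriGubler2006, §1.5] -/
theorem sum_mult_mul_posLog_inv_le_of_forall (x : L) {c : ℝ}
    (h : ∀ v : InfinitePlace L, log⁺ (v x⁻¹) ≤ c) :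
    ∑ v : InfinitePlace L, (v.mult : ℝ) * log⁺ (v x⁻¹) ≤ (Module.finrank ℚ L : ℝ) * c := by
  calc ∑ v : InfinitePlace L, (v.mult : ℝ) * log⁺ (v x⁻¹)
      ≤ ∑ v : InfinitePlace L, (v.mult : ℝ) * c :=
        Finset.sum_le_sum fun v _ => mul_le_mul_of_nonneg_left (h v) (Nat.cast_nonneg _)
    _ = (∑ v : InfinitePlace L, (v.mult : ℝ)) * c := by rw [Finset.sum_mul]
    _ = (Module.finrank ℚ L : ℝ) * c := by
        rw [← Nat.cast_sum, NumberField.InfinitePlace.sum_mult_eq]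

/-- **Normalised form** of `sum_logNorm_le_of_placewise`: with `h(x) := logHeight₁ x / [L:ℚ]` (the
absolute logarithmic Weil height, the tree's `NFPoint.ht` convention) and
`κ := (1/[L:ℚ])·Σ_{w ∈ W} log N(w)` (a normalised log-conductor),
`κ ≤ Σ_i h(τ_i) − h(a) + (A + D)/[L:ℚ]`. [cite: MochizukiGenEll2010, Thm 2.1 proof pp.12-13] -/
theorem inv_finrank_mul_sum_logNorm_le_of_placewise {ι : Type*} [Fintype ι] (a : L) (τ : ι → L)
    (W Sd : Finset (HeightOneSpectrum (𝓞 L))) (d : HeightOneSpectrum (𝓞 L) → ℕ) {A D : ℝ}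
    (hmeet : ∀ w ∈ W, 1 + (ord L w a).toNat ≤ (∑ i, (ord L w (τ i)).toNat) + d w)
    (hoff : ∀ w, w ∉ W → (ord L w a).toNat ≤ (∑ i, (ord L w (τ i)).toNat) + d w)
    (hdS : ∀ w, w ∉ Sd → d w = 0)
    (hD : ∑ w ∈ Sd, (d w : ℝ) * logNorm L w ≤ D)
    (hA : ∑ v : InfinitePlace L, (v.mult : ℝ) * log⁺ (v a⁻¹) ≤ A) :
    (Module.finrank ℚ L : ℝ)⁻¹ * ∑ w ∈ W, logNorm L w ≤
      (∑ i, (Module.finrank ℚ L : ℝ)⁻¹ * logHeight₁ (τ i)) -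
        (Module.finrank ℚ L : ℝ)⁻¹ * logHeight₁ a + (Module.finrank ℚ L : ℝ)⁻¹ * (A + D) := by
  have hn : (0 : ℝ) < Module.finrank ℚ L := by exact_mod_cast Module.finrank_pos
  have h := sum_logNorm_le_of_placewise a τ W Sd d hmeet hoff hdS hD hA
  rw [← Finset.mul_sum, ← mul_sub, ← mul_add]
  exact mul_le_mul_of_nonneg_left (by linarith) (inv_nonneg.mpr hn.le)

end Literature.NumberTheory.DiophantineGeometry.FibreConductor
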